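import Summits.QuantumFields.BalabanUV.T4Continuum.Spine.NE4.Targets
import Summits.QuantumFields.BalabanUV.T4Continuum.Support.NE7MarginalL1Runs
import Summits.QuantumFields.BalabanUV.T4Continuum.Support.NE7MarginalL1Currency

/-!
# Spine/NE4/Necessity — NE4 ALONG THE RUNS is NECESSARY for node U2's output (the converse of `T4CouplingMatching.disc_step`),
# and along the runs it is also sufficient: node U2's own door is shut in both directions

Cell `pub-balaban-gaps` (YM blitz G2), seat `ne4` generation 2 (unit `pub-balaban-gaps-ne4-g2`), record `HOME/ne/NE4.md` §5 census line (R26).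
Sibling of `Spine/NE4/Targets` (generation 0, p338704): there the spine row NE4 (`T4CouplingMatching.ScaleShiftRate` — the η-rate of the
FULL β-functions, node U2 of the T⁴ uniqueness spine) was stated ON THE DATA together with node U2's output `U2Output D g₀ Cout θ`
(K-uniform geometric matching `|1/(g^{(K)}_j)² − 1/(g^{(K+1)}_{j+1})²| ≤ Cout·θ^j` of the couplings of CONSECUTIVE tuned runs) and the
landed face `u2Output_of_u2Inputs` (NE4 + history moduli with fading memory + window ⇒ output).

WHAT THIS FILE ADDS (kernel bookkeeping, elementary real analysis; NOTHING of Bałaban's asserted).  The census question «can node U2's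
output be reached WITHOUT NE4, by some other matching argument?» answered in the negative AT THE LEVEL OF THE RUNS:
§1 `abs_shift_le_of_disc` — the recursion (0.20) of [Balaban1987RG1] p. 256 for run A (`K` steps) and run B (`K+1` steps) is an
   IDENTITY, so the scale shift of `β` evaluated ON RUN B's OWN HISTORY, `β_{j+2}(g^B_0,…,g^B_{j+1}) − β_{j+1}(g^B_1,…,g^B_{j+1})`, equals
   `(δ_{j+1} − δ_j)`-type differences of the two-run discrepancies plus the history shift at scale `j`; hence
   `|shift_j| ≤ disc_j + disc_{j+1} + Σ_{i≤j} Λ_{j,i}·(g^A_i)² g^B_{i+1}·disc_i` under the history moduli `HistLipschitz Λ` alone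
   (the literal converse of the tree's `disc_step` / `NE7MarginalL1Runs.disc_step_along`).
§2 `abs_shift_le_geom_of_disc` — with fading memory `Λ_{j,i} ≤ C·θ^{j−i}`, the AF weight sum `Σ_{i≤K}(g^A_i)² g^B_{i+1} ≤ U` and a
   geometric discrepancy bound `disc_i ≤ D·θ^i` (`i ≤ K`): `|shift_j| ≤ D·(1 + θ + C·U)·θ^j` for `j < K` — NO window/smallness needed in
   this direction; `shiftAlongRun_of_discGeom` — the same packaged as the NE7-ℓ¹ road's supplier shape
   `NE7MarginalL1Currency.ShiftAlongRun (fun j ↦ D(1+θ+CU)θ^j) β g^B K`.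
§3 `disc_le_of_shiftAlong_geom` — the forward direction ALONG THE RUN in the same (geometric, K-uniform) currency: the tree's
   `disc_le_of_fadingMemory` with `ScaleShiftRate c θ γ β` (a bound on the whole box `]0,γ]^{k+2}`) weakened to
   `ShiftAlongRun (fun j ↦ cθ^j) β g^B K` (a bound at run B's realised history only) — `disc_step_along` + the tree's `twoSided_fixedPoint`,
   window `C·U ≤ (1−θ)/2` as there.  (The ℓ¹/smeared currency of this direction is `NE7MarginalL1Runs.disc_le_of_shiftAlong_fadingMemory`.)
§4 ON THE DATA: `ne4AlongRuns_of_u2Output` — `U2Output D g₀ Cout θ` for a sequence `g₀` tuned within `]0,γ]` + the history half of node U2's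
   triple (`HistLipschitz Λ γ D.βfun`, `FadingMemory C θ Λ`) + the AF binders that bound the weights (`EventualLowerH b γ k₀`, and `BetaUpperH`
   with `γ²β′ < 1` only to run (0.20) forward, `rgEqH_of_tuned`) ⇒ NE4 ALONG EVERY TUNED RUN of the data:
   `ShiftAlongRun (fun j ↦ Cout(1+θ+C((k₀+1)γ³+2γ/b))θ^j) D.βfun (runFlow D g₀ (K+1)) K` for every `K`; and `u2Output_of_ne4AlongRuns` — the
   converse on the data under the window.  TOGETHER: modulo node U2's history/memory companions (row NE9's shapes) and the AF weight binders,
   «NE4 along the tuned runs, geometric and K-uniform» and «node U2's output» are EQUIVALENT (constants `c ↦ 2c/(1−θ)`, `Cout ↦ Cout(1+θ+CU)`).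
   CONSEQUENCE FOR THE CENSUS (NE4.md (R26)): no argument can deliver node U2's output for Bałaban's data without proving NE4 on the realised
   histories; the only slack between the spine's NE4 (`ScaleShiftRate` on the full boxes) and what node U6 forces is OFF-TRAJECTORY (histories
   in `]0,γ]^{k+2}` that no tuned run visits) — a slack no consumer in the tree uses (`disc_step` evaluates `ScaleShiftRate` at run B's prefix only).
§5 (v1.1) ℓ¹ CURRENCY (the NE7 crux's route ℓ¹): `shiftAlongRun_of_discEnvelope`, `sum_discEnvelope_le`, `ne4AlongRuns_of_discEnvelope` — a K-uniform
   discrepancy envelope `d` forces the K-uniform shift envelope `d_j + d_{j+1} + Cγ³Σ_{i≤j}θ^{j−i}d_i`, with partial sums `≤ (2 + Cγ³(1−θ)⁻¹)Σ_{i≤N}d_i`: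
   summable K-uniform matching ⇒ summable K-uniform NE4-along-runs, no window.

WHAT THIS FILE IS NOT.  Not an estimate, not an instance: every NE-shape and `U2Output` is a BINDER; NE4 is NOT IN PRINT ([Balaban1987RG1] p. 264
«We will investigate other properties in a separate paper»; p. 298; cell GAPS G-t4-U2-1, G-t4-U2-2), NOT PROVED, booked DEPENDENT = (R)∘{NE5, NE9}; spine
PROVED 0/9 unchanged.  HONEST FRAMING: rung (B)+1 bookkeeping on ONE finite T⁴ — NOT the continuum limit on ℝ⁴, NOT infinite volume, NOT a mass
gap, NOT Clay.  HONEST DEPENDENCY: continuum YM on T⁴ ⇐ BetaPertH ∧ nine spine estimates (0/9 proved); BetaPertH ⇐ (D1) ∧ (D4) ∧ CAP+tail.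
0 sorry; axioms standard; imports `Spine/NE4/Targets` and the NE7 crux's ℓ¹-road files `Support/NE7MarginalL1Runs` (`disc_step_along`) and
`Support/NE7MarginalL1Currency` (the shape `ShiftAlongRun`), modifies nothing.

References (locators only): [Balaban1987RG1] = T. Bałaban, Commun. Math. Phys. **109** (1987) 249–301: (0.20) p. 256, Thm 2 p. 259 (tuning
`g_K = g`), p. 264, p. 298.
-/

noncomputable section

namespace Summit.QuantumFields.BalabanUV.T4Continuum.Spine.NE4

open Finset
open Literature.MathematicalPhysics.QuantumFieldTheory.Balaban1983to89
open Literature.MathematicalPhysics.QuantumFieldTheory.Balaban1983to89.FlowStep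
open Literature.MathematicalPhysics.QuantumFieldTheory.Balaban1983to89.T4CouplingMatching
open Literature.MathematicalPhysics.QuantumFieldTheory.Balaban1983to89.T4Continuum
open Literature.MathematicalPhysics.QuantumFieldTheory.Balaban1983to89.T4TwoRunUniqueness (rgEqH_of_tuned)
open Summit.QuantumFields.BalabanUV.T4Continuum.NE7MarginalL1Runs (disc_step_along)
open Summit.QuantumFields.BalabanUV.T4Continuum.NE7MarginalL1Currency (ShiftAlongRun)

universe u

variable {F : T4Family} {G : Type u} [GaugeGroup G] [MeasurableSpace G] [HaarData G]

/-! ## §1 The converse of `disc_step`: the scale shift along run B is controlled by the two-run discrepancies -/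

/-- **NE4 ALONG RUN B ⇐ THE DISCREPANCIES (pointwise; the converse of `T4CouplingMatching.disc_step`).**  Two runs of the recursion
(0.20) with the same history-dependent family `β` — A: `K` steps, B: `K+1` steps, couplings in `]0,γ]` — and history moduli
`HistLipschitz Λ γ β` with `Λ ≥ 0`.  Then for `j < K` the scale shift of `β` AT RUN B's PREFIX is bounded by the discrepancies:
`|β_{j+2}(g^B_0..g^B_{j+1}) − β_{j+1}(g^B_1..g^B_{j+1})| ≤ disc_j + disc_{j+1} + Σ_{i≤j} Λ_{j,i}(g^A_i)²g^B_{i+1}·disc_i`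
(subtract (0.20) of run A at step `j` from (0.20) of run B at step `j+1`: an identity; then `abs_sub_le_of_inv_sq` coordinatewise).
No pin, no window, no rate.  β-side hypotheses UNPRINTED binders. [cite: Balaban1987RG1, (0.20) p.256] -/
theorem abs_shift_le_of_disc {β : HBeta} {γ : ℝ} {Λ : ℕ → ℕ → ℝ} {K : ℕ} {gA gB : ℕ → ℝ}
    (hA : RGEqH K β gA) (hB : RGEqH (K + 1) β gB)
    (hAbox : ∀ i, i ≤ K → 0 < gA i ∧ gA i ≤ γ) (hBbox : ∀ i, i ≤ K + 1 → 0 < gB i ∧ gB i ≤ γ)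
    (hL : HistLipschitz Λ γ β) (hΛ : ∀ k i, i ≤ k → 0 ≤ Λ k i) {j : ℕ} (hj : j < K) :
    |β (j + 1) (prefixOf gB (j + 1)) - β j (Fin.tail (prefixOf gB (j + 1)))|
      ≤ disc gA gB j + disc gA gB (j + 1)
        + ∑ i ∈ range (j + 1), Λ j i * ((gA i) ^ 2 * gB (i + 1)) * disc gA gB i := by
  have eA := hA j hj
  have eB := hB (j + 1) (by omega)
  have hpA : prefixOf gA j ∈ Box γ j := prefixOf_mem_box hj.le hAbox
  have htail : Fin.tail (prefixOf gB (j + 1)) ∈ Box γ j := by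
    rw [tail_prefixOf]
    exact prefixOf_mem_box (N := K) hj.le fun i hi => hBbox (i + 1) (by omega)
  have h2 := hL j (Fin.tail (prefixOf gB (j + 1))) (prefixOf gA j) htail hpA
  have h3 : ∑ i : Fin (j + 1), Λ j i * |Fin.tail (prefixOf gB (j + 1)) i - prefixOf gA j i|
      ≤ ∑ i ∈ range (j + 1), Λ j i * ((gA i) ^ 2 * gB (i + 1)) * disc gA gB i := by
    rw [Finset.sum_range (fun i => Λ j i * ((gA i) ^ 2 * gB (i + 1)) * disc gA gB i)]
    refine Finset.sum_le_sum fun i _ => ?_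
    have hiK : (i : ℕ) ≤ K := by have := i.isLt; omega
    have hgA := hAbox i hiK
    have hgB := hBbox (i + 1) (by omega)
    simp only [Fin.tail, prefixOf_apply, Fin.val_succ]
    rw [abs_sub_comm, mul_assoc]
    exact mul_le_mul_of_nonneg_left (abs_sub_le_of_inv_sq hgA.1 hgB.1) (hΛ j i (Nat.lt_succ_iff.mp i.isLt))
  have key : β (j + 1) (prefixOf gB (j + 1)) - β j (Fin.tail (prefixOf gB (j + 1)))
      = (1 / gA (j + 1) ^ 2 - 1 / gB (j + 1 + 1) ^ 2) - (1 / gA j ^ 2 - 1 / gB (j + 1) ^ 2)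
        + (β j (prefixOf gA j) - β j (Fin.tail (prefixOf gB (j + 1)))) := by
    rw [eA, eB]
    ring
  have habs : |β (j + 1) (prefixOf gB (j + 1)) - β j (Fin.tail (prefixOf gB (j + 1)))|
      ≤ disc gA gB (j + 1) + disc gA gB j + |β j (prefixOf gA j) - β j (Fin.tail (prefixOf gB (j + 1)))| := by
    rw [key]
    simp only [disc]
    exact (abs_add_le _ _).trans (add_le_add (abs_sub _ _) le_rfl)
  have hcomm : |β j (prefixOf gA j) - β j (Fin.tail (prefixOf gB (j + 1)))|
      = |β j (Fin.tail (prefixOf gB (j + 1))) - β j (prefixOf gA j)| := abs_sub_comm _ _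
  linarith [habs, hcomm, h2, h3]

/-! ## §2 Geometric currency: a K-uniform geometric matching forces NE4 along run B, with NO window -/

/-- **NE4 ALONG RUN B ⇐ GEOMETRIC MATCHING (the necessity of NE4 in node U2's own currency).**  Same two runs; history moduli with
FADING MEMORY `Λ_{j,i} ≤ C·θ^{j−i}` (`0 ≤ θ ≤ 1`); the AF weight sum `Σ_{i≤K}(g^A_i)²g^B_{i+1} ≤ U`; and the discrepancies bounded
geometrically, `disc_i ≤ D·θ^i` for `i ≤ K` (node U2's OUTPUT for this pair).  Then for every `j < K`:
`|β_{j+2}(g^B_0..g^B_{j+1}) − β_{j+1}(g^B_1..g^B_{j+1})| ≤ D·(1 + θ + C·U)·θ^j` — §1, `θ^{j−i}·θ^i = θ^j`, and `Σ_{i≤j} ≤ Σ_{i≤K}` on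
nonnegative weights.  No smallness condition in this direction. [cite: Balaban1987RG1, (0.20) p.256] -/
theorem abs_shift_le_geom_of_disc {β : HBeta} {γ θ C U D : ℝ} {Λ : ℕ → ℕ → ℝ} {K : ℕ} {gA gB : ℕ → ℝ}
    (hθ0 : 0 ≤ θ) (hD : 0 ≤ D)
    (hA : RGEqH K β gA) (hB : RGEqH (K + 1) β gB)
    (hAbox : ∀ i, i ≤ K → 0 < gA i ∧ gA i ≤ γ) (hBbox : ∀ i, i ≤ K + 1 → 0 < gB i ∧ gB i ≤ γ)
    (hL : HistLipschitz Λ γ β) (hΛ : FadingMemory C θ Λ)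
    (hU : ∑ i ∈ range (K + 1), (gA i) ^ 2 * gB (i + 1) ≤ U)
    (hdisc : ∀ i, i ≤ K → disc gA gB i ≤ D * θ ^ i) {j : ℕ} (hj : j < K) :
    |β (j + 1) (prefixOf gB (j + 1)) - β j (Fin.tail (prefixOf gB (j + 1)))| ≤ D * (1 + θ + C * U) * θ ^ j := by
  have hC : 0 ≤ C := by
    have h0 := hΛ 0 0 le_rfl
    simpa using h0.1.trans h0.2
  have hw : ∀ i, i ≤ K → 0 ≤ (gA i) ^ 2 * gB (i + 1) := fun i hi =>
    mul_nonneg (sq_nonneg _) (hBbox (i + 1) (by omega)).1.le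
  have h1 := abs_shift_le_of_disc hA hB hAbox hBbox hL (fun k i hik => (hΛ k i hik).1) hj
  have hterm : ∀ i ∈ range (j + 1),
      Λ j i * ((gA i) ^ 2 * gB (i + 1)) * disc gA gB i ≤ C * D * θ ^ j * ((gA i) ^ 2 * gB (i + 1)) := by
    intro i hi
    have hij : i ≤ j := Nat.lt_succ_iff.mp (mem_range.mp hi)
    have hiK : i ≤ K := by omega
    have hpow : θ ^ (j - i) * θ ^ i = θ ^ j := by rw [← pow_add, Nat.sub_add_cancel hij]
    calc Λ j i * ((gA i) ^ 2 * gB (i + 1)) * disc gA gB i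
        ≤ (C * θ ^ (j - i)) * ((gA i) ^ 2 * gB (i + 1)) * (D * θ ^ i) :=
          mul_le_mul (mul_le_mul_of_nonneg_right (hΛ j i hij).2 (hw i hiK)) (hdisc i hiK) (disc_nonneg _ _ _)
            (mul_nonneg (mul_nonneg hC (pow_nonneg hθ0 _)) (hw i hiK))
      _ = C * D * (θ ^ (j - i) * θ ^ i) * ((gA i) ^ 2 * gB (i + 1)) := by ring
      _ = C * D * θ ^ j * ((gA i) ^ 2 * gB (i + 1)) := by rw [hpow]
  have hS : ∑ i ∈ range (j + 1), Λ j i * ((gA i) ^ 2 * gB (i + 1)) * disc gA gB i ≤ C * D * θ ^ j * U := by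
    calc ∑ i ∈ range (j + 1), Λ j i * ((gA i) ^ 2 * gB (i + 1)) * disc gA gB i
        ≤ ∑ i ∈ range (j + 1), C * D * θ ^ j * ((gA i) ^ 2 * gB (i + 1)) := Finset.sum_le_sum hterm
      _ = C * D * θ ^ j * ∑ i ∈ range (j + 1), (gA i) ^ 2 * gB (i + 1) := by rw [Finset.mul_sum]
      _ ≤ C * D * θ ^ j * U := by
          refine mul_le_mul_of_nonneg_left ?_ (mul_nonneg (mul_nonneg hC hD) (pow_nonneg hθ0 _))
          calc ∑ i ∈ range (j + 1), (gA i) ^ 2 * gB (i + 1) ≤ ∑ i ∈ range (K + 1), (gA i) ^ 2 * gB (i + 1) :=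
                Finset.sum_le_sum_of_subset_of_nonneg (Finset.range_mono (by omega))
                  (fun i hi _ => hw i (Nat.lt_succ_iff.mp (mem_range.mp hi)))
            _ ≤ U := hU
  have hd0 := hdisc j hj.le
  have hd1 := hdisc (j + 1) hj
  calc |β (j + 1) (prefixOf gB (j + 1)) - β j (Fin.tail (prefixOf gB (j + 1)))|
      ≤ disc gA gB j + disc gA gB (j + 1)
          + ∑ i ∈ range (j + 1), Λ j i * ((gA i) ^ 2 * gB (i + 1)) * disc gA gB i := h1
    _ ≤ D * θ ^ j + D * θ ^ (j + 1) + C * D * θ ^ j * U := by linarith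
    _ = D * (1 + θ + C * U) * θ ^ j := by ring

/-- The same, PACKAGED in the NE7-ℓ¹ road's supplier shape: a geometric matching `disc_i ≤ Dθ^i` (`i ≤ K`) of the pair gives
`ShiftAlongRun (fun j ↦ D(1+θ+CU)θ^j) β g^B K` (NE4 at run B's realised histories, K-uniform constant). [cite: Balaban1987RG1, (0.20) p.256] -/
theorem shiftAlongRun_of_discGeom {β : HBeta} {γ θ C U D : ℝ} {Λ : ℕ → ℕ → ℝ} {K : ℕ} {gA gB : ℕ → ℝ}
    (hθ0 : 0 ≤ θ) (hD : 0 ≤ D)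
    (hA : RGEqH K β gA) (hB : RGEqH (K + 1) β gB)
    (hAbox : ∀ i, i ≤ K → 0 < gA i ∧ gA i ≤ γ) (hBbox : ∀ i, i ≤ K + 1 → 0 < gB i ∧ gB i ≤ γ)
    (hL : HistLipschitz Λ γ β) (hΛ : FadingMemory C θ Λ)
    (hU : ∑ i ∈ range (K + 1), (gA i) ^ 2 * gB (i + 1) ≤ U)
    (hdisc : ∀ i, i ≤ K → disc gA gB i ≤ D * θ ^ i) :
    ShiftAlongRun (fun j => D * (1 + θ + C * U) * θ ^ j) β gB K := fun _ hj =>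
  abs_shift_le_geom_of_disc hθ0 hD hA hB hAbox hBbox hL hΛ hU hdisc hj

/-! ## §3 The forward direction ALONG THE RUN, geometric currency (the tree's `disc_le_of_fadingMemory` with NE4 at run B's prefix only) -/

/-- **NODE U2's MATCHING ⇐ NE4 ALONG RUN B** (K-uniform geometric currency).  `T4CouplingMatching.disc_le_of_fadingMemory` verbatim, except that
the scale-shift input is consumed only where `disc_step` consumes it — at run B's realised prefixes: `ShiftAlongRun (fun j ↦ cθ^j) β g^B K` in
place of `ScaleShiftRate c θ γ β`.  Pinned runs (`g^A_K = g^B_{K+1}`), `HistLipschitz Λ`, `FadingMemory C θ Λ`, weights `≤ U`, window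
`C·U ≤ (1−θ)/2` ⇒ `disc_j ≤ (2c/(1−θ))·θ^j` for `j ≤ K` (`disc_step_along` + `twoSided_fixedPoint`). [cite: Balaban1987RG1, (0.20) p.256, Thm 2 p.259] -/
theorem disc_le_of_shiftAlong_geom {β : HBeta} {γ c θ C U : ℝ} {Λ : ℕ → ℕ → ℝ} {K : ℕ} {gA gB : ℕ → ℝ}
    (hθ0 : 0 < θ) (hθ1 : θ < 1) (hc : 0 ≤ c)
    (hA : RGEqH K β gA) (hB : RGEqH (K + 1) β gB)
    (hAbox : ∀ i, i ≤ K → 0 < gA i ∧ gA i ≤ γ) (hBbox : ∀ i, i ≤ K + 1 → 0 < gB i ∧ gB i ≤ γ)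
    (hpin : gA K = gB (K + 1))
    (hS : ShiftAlongRun (fun j => c * θ ^ j) β gB K) (hL : HistLipschitz Λ γ β) (hΛ : FadingMemory C θ Λ)
    (hU : ∑ i ∈ range (K + 1), (gA i) ^ 2 * gB (i + 1) ≤ U) (hsmall : C * U ≤ (1 - θ) / 2) :
    ∀ j, j ≤ K → disc gA gB j ≤ 2 * c / (1 - θ) * θ ^ j := by
  have hC : 0 ≤ C := by
    have h0 := hΛ 0 0 le_rfl
    simpa using h0.1.trans h0.2
  have hu : ∀ i, i ≤ K → 0 ≤ (gA i) ^ 2 * gB (i + 1) := fun i hi =>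
    mul_nonneg (sq_nonneg _) (hBbox (i + 1) (by omega)).1.le
  refine twoSided_fixedPoint (u := fun i => (gA i) ^ 2 * gB (i + 1)) hθ0 hθ1 hc hC
    (disc_nonneg gA gB) hu hU hsmall (disc_pin hpin) ?_
  intro j hj
  have hstep := disc_step_along hA hB hAbox hBbox hL (fun k i hik => (hΛ k i hik).1) hj (hS j hj)
  have hsum : ∑ i ∈ range (j + 1), Λ j i * ((gA i) ^ 2 * gB (i + 1)) * disc gA gB i
      ≤ C * ∑ i ∈ range (j + 1), θ ^ (j - i) * ((gA i) ^ 2 * gB (i + 1)) * disc gA gB i := by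
    rw [Finset.mul_sum]
    refine Finset.sum_le_sum fun i hi => ?_
    have hij : i ≤ j := Nat.lt_succ_iff.mp (mem_range.mp hi)
    have hiK : i ≤ K := by omega
    have hnn : 0 ≤ (gA i) ^ 2 * gB (i + 1) * disc gA gB i := mul_nonneg (hu i hiK) (disc_nonneg _ _ _)
    calc Λ j i * ((gA i) ^ 2 * gB (i + 1)) * disc gA gB i
        = Λ j i * ((gA i) ^ 2 * gB (i + 1) * disc gA gB i) := by ring
      _ ≤ C * θ ^ (j - i) * ((gA i) ^ 2 * gB (i + 1) * disc gA gB i) :=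
          mul_le_mul_of_nonneg_right (hΛ j i hij).2 hnn
      _ = C * (θ ^ (j - i) * ((gA i) ^ 2 * gB (i + 1)) * disc gA gB i) := by ring
  have e : (fun j => c * θ ^ j) j = c * θ ^ j := rfl
  linarith [hstep, hsum, e]

/-! ## §4 On the data: node U2's output and NE4 along the tuned runs are equivalent modulo the history/memory companions -/

/-- **NE4 ALONG THE DATA's TUNED RUNS ⇐ NODE U2's OUTPUT** (necessity, on `D : FiniteEpsData`).  `U2Output D g₀ Cout θ` (the
K-uniform geometric matching of CONSECUTIVE runs' couplings along a bare-coupling sequence `g₀`, `0 ≤ θ`), `g₀` TUNED to `g` within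
`]0,γ]` ([Balaban1987RG1] Thm 2 p. 259), the history half of node U2's triple on `D.βfun` (`HistLipschitz Λ γ`, `FadingMemory C θ Λ`),
the eventual lower bound `EventualLowerH b γ k₀ D.βfun` (`b > 0`; only to bound the AF weights, `sum_weights_le_of_eventualLower`) and
the printed-type `BetaUpperH β′ γ D.βfun` with `γ²β′ < 1` (only to run (0.20) forward, `rgEqH_of_tuned`) ⇒ for EVERY `K`, NE4 holds along
run `K+1`'s realised history with the K-UNIFORM constant `Cout·(1 + θ + C·((k₀+1)γ³ + 2γ/b))`:
`ShiftAlongRun (fun j ↦ Cout(1+θ+C((k₀+1)γ³+2γ/b))θ^j) D.βfun (runFlow D g₀ (K+1)) K`.  No window.  Every β-side binder UNPRINTED;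
bookkeeping (§2 + `box_and_pin_of_tuned`). [cite: Balaban1987RG1, (0.20) p.256, Thm 2 p.259] -/
theorem ne4AlongRuns_of_u2Output (D : FiniteEpsData F G) {Cout θ γ C b β' g : ℝ} {k₀ : ℕ} {Λ : ℕ → ℕ → ℝ}
    {g₀ : ℕ → ℝ} (hO : U2Output D g₀ Cout θ) (hθ0 : 0 ≤ θ)
    (hL : HistLipschitz Λ γ D.βfun) (hΛ : FadingMemory C θ Λ)
    (hγ : 0 < γ) (hb : 0 < b) (hlo : EventualLowerH b γ k₀ D.βfun)
    (hhi : BetaUpperH β' γ D.βfun) (hγβ : γ ^ 2 * β' < 1) (ht : D.Tuned γ g g₀) (K : ℕ) :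
    ShiftAlongRun (fun j => Cout * (1 + θ + C * (((k₀ : ℝ) + 1) * γ ^ 3 + 2 * γ / b)) * θ ^ j) D.βfun
      (runFlow D g₀ (K + 1)) K := by
  obtain ⟨hbox, hpin⟩ := box_and_pin_of_tuned D ht
  have hrun : ∀ K, RGEqH K D.βfun (runFlow D g₀ K) := fun K => rgEqH_of_tuned D hhi hγβ hγ le_rfl ht K
  have hdisc : ∀ i, i ≤ K → disc (runFlow D g₀ K) (runFlow D g₀ (K + 1)) i ≤ Cout * θ ^ i := by
    intro i hi
    have h := (hO K i hi).2
    simpa using h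
  have hCout : 0 ≤ Cout := by
    have h0 := hO K 0 (Nat.zero_le K)
    have h := h0.1.trans h0.2
    simpa using h
  have hU := sum_weights_le_of_eventualLower hγ hb (hrun K) (hrun (K + 1)) (hbox K) (hbox (K + 1)) hlo
  exact shiftAlongRun_of_discGeom hθ0 hCout (hrun K) (hrun (K + 1)) (hbox K) (hbox (K + 1)) hL hΛ hU hdisc

/-- **NODE U2's OUTPUT ⇐ NE4 ALONG THE DATA's TUNED RUNS** (sufficiency at the runs: `Targets.u2Output_of_u2Inputs` with NE4 weakened from
the boxes to the realised histories).  For a sequence `g₀` tuned to `g` within `]0,γ]`: NE4 along every run `K+1` with ONE constant,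
`∀ K, ShiftAlongRun (fun j ↦ cθ^j) D.βfun (runFlow D g₀ (K+1)) K` (`0 < θ < 1`, `c ≥ 0`), the history half of the triple, `EventualLowerH b γ k₀`,
`BetaUpperH β′ γ` with `γ²β′ < 1`, and the window `C·((k₀+1)γ³ + 2γ/b) ≤ (1−θ)/2` ⇒ `U2Output D g₀ (2c/(1−θ)) θ` (§3 run by run +
`sum_weights_le_of_eventualLower`).  With `ne4AlongRuns_of_u2Output`: the two data-level statements are EQUIVALENT modulo these companions
(constants `c ↦ 2c/(1−θ)`, `Cout ↦ Cout(1+θ+CU)`).  β-side binders UNPRINTED; bookkeeping. [cite: Balaban1987RG1, (0.20) p.256, Thm 2 p.259] -/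
theorem u2Output_of_ne4AlongRuns (D : FiniteEpsData F G) {c θ γ C b β' g : ℝ} {k₀ : ℕ} {Λ : ℕ → ℕ → ℝ} {g₀ : ℕ → ℝ}
    (hS : ∀ K, ShiftAlongRun (fun j => c * θ ^ j) D.βfun (runFlow D g₀ (K + 1)) K)
    (hθ0 : 0 < θ) (hθ1 : θ < 1) (hc : 0 ≤ c)
    (hL : HistLipschitz Λ γ D.βfun) (hΛ : FadingMemory C θ Λ)
    (hγ : 0 < γ) (hb : 0 < b) (hlo : EventualLowerH b γ k₀ D.βfun)
    (hhi : BetaUpperH β' γ D.βfun) (hγβ : γ ^ 2 * β' < 1) (ht : D.Tuned γ g g₀)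
    (hsmall : C * (((k₀ : ℝ) + 1) * γ ^ 3 + 2 * γ / b) ≤ (1 - θ) / 2) :
    U2Output D g₀ (2 * c / (1 - θ)) θ := by
  obtain ⟨hbox, hpin⟩ := box_and_pin_of_tuned D ht
  have hrun : ∀ K, RGEqH K D.βfun (runFlow D g₀ K) := fun K => rgEqH_of_tuned D hhi hγβ hγ le_rfl ht K
  intro K j hj
  refine ⟨disc_nonneg _ _ _, ?_⟩
  have hU := sum_weights_le_of_eventualLower hγ hb (hrun K) (hrun (K + 1)) (hbox K) (hbox (K + 1)) hlo
  have h := disc_le_of_shiftAlong_geom hθ0 hθ1 hc (hrun K) (hrun (K + 1)) (hbox K) (hbox (K + 1))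
    ((hpin K).trans (hpin (K + 1)).symm) (hS K) hL hΛ hU hsmall j hj
  simpa using h

/-- **THE SPINE's NE4 (on the boxes) ⇒ NE4 ALONG EVERY RUN** (the trivial direction, recorded so that the three data-level statements line up:
`NE4OnData D c θ γ` ⇒ `∀ K, ShiftAlongRun (cθ^·) D.βfun (runFlow D g₀ (K+1)) K` ⇒ (window) `U2Output` ⇒ `ShiftAlongRun` again): for a sequence
tuned within `]0,γ]`, `ScaleShiftRate c θ γ D.βfun` restricted to run `K+1`'s prefixes (`NE7MarginalL1Supply.shiftAlong_of_scaleShiftRate`'s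
content, re-derived in two lines to keep the imports of this file minimal). [folklore] -/
theorem ne4AlongRuns_of_ne4OnData (D : FiniteEpsData F G) {c θ γ g : ℝ} {g₀ : ℕ → ℝ} (h : NE4OnData D c θ γ)
    (ht : D.Tuned γ g g₀) (K : ℕ) : ShiftAlongRun (fun j => c * θ ^ j) D.βfun (runFlow D g₀ (K + 1)) K := by
  intro j hj
  obtain ⟨hbox, -⟩ := box_and_pin_of_tuned D ht
  exact h j (prefixOf (runFlow D g₀ (K + 1)) (j + 1)) (prefixOf_mem_box (N := K + 1) (by omega) (hbox (K + 1)))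

/-! ## §5 ℓ¹ currency (appended, v1.1): a K-uniform discrepancy ENVELOPE forces a K-uniform shift envelope with dominated partial sums

The NE7 crux's route ℓ¹ (`NE7MarginalL1Currency` / `NE7MarginalL1Runs` / `NE7MarginalL1Supply`) consumes the along-run shift through a K-UNIFORM
envelope `σ` with summable partial sums instead of `cθ^j`.  The necessity of §1–§2 holds in that currency too: a K-uniform envelope `d` of the
discrepancies produces the explicit K-uniform shift envelope `j ↦ d_j + d_{j+1} + C·γ³·Σ_{i≤j} θ^{j−i} d_i` (no window), whose partial sums are
`≤ (2 + Cγ³(1−θ)⁻¹)·Σ_{i≤N} d_i` — so «Σ_j sup_K disc^{(K)}_j < ∞» forces «Σ_j sup_K |shift^{(K)}_j| < ∞» modulo the same companions. -/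

/-- **ℓ¹ NECESSITY, POINTWISE ENVELOPE.**  Two runs of (0.20) as in §1 (couplings in `]0,γ]`, `0 ≤ γ`), `HistLipschitz Λ γ β`, `FadingMemory C θ Λ`
(`0 ≤ θ`), and a discrepancy envelope `disc_i ≤ d_i` for `i ≤ K` (`d` arbitrary, typically K-UNIFORM).  Then run B's scale shift is under the
K-uniform envelope built from `d` alone: `ShiftAlongRun (fun j ↦ d j + d (j+1) + C·γ³·Σ_{i<j+1} θ^{j−i}·d i) β g^B K` (§1 + `Λ_{j,i} ≤ Cθ^{j−i}` +
the weights `(g^A_i)²g^B_{i+1} ≤ γ³`).  No window, no pin. [cite: Balaban1987RG1, (0.20) p.256] -/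
theorem shiftAlongRun_of_discEnvelope {β : HBeta} {γ θ C : ℝ} {Λ : ℕ → ℕ → ℝ} {K : ℕ} {gA gB : ℕ → ℝ} {d : ℕ → ℝ}
    (hθ0 : 0 ≤ θ) (hγ : 0 ≤ γ)
    (hA : RGEqH K β gA) (hB : RGEqH (K + 1) β gB)
    (hAbox : ∀ i, i ≤ K → 0 < gA i ∧ gA i ≤ γ) (hBbox : ∀ i, i ≤ K + 1 → 0 < gB i ∧ gB i ≤ γ)
    (hL : HistLipschitz Λ γ β) (hΛ : FadingMemory C θ Λ)
    (hdisc : ∀ i, i ≤ K → disc gA gB i ≤ d i) :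
    ShiftAlongRun (fun j => d j + d (j + 1) + C * γ ^ 3 * ∑ i ∈ range (j + 1), θ ^ (j - i) * d i) β gB K := by
  intro j hj
  have hC : 0 ≤ C := by
    have h0 := hΛ 0 0 le_rfl
    simpa using h0.1.trans h0.2
  have h1 := abs_shift_le_of_disc hA hB hAbox hBbox hL (fun k i hik => (hΛ k i hik).1) hj
  have hw : ∀ i, i ≤ K → 0 ≤ (gA i) ^ 2 * gB (i + 1) ∧ (gA i) ^ 2 * gB (i + 1) ≤ γ ^ 3 := by
    intro i hi
    have hgA := hAbox i hi
    have hgB := hBbox (i + 1) (by omega)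
    refine ⟨mul_nonneg (sq_nonneg _) hgB.1.le, ?_⟩
    have hsq : (gA i) ^ 2 ≤ γ ^ 2 := pow_le_pow_left₀ hgA.1.le hgA.2 2
    calc (gA i) ^ 2 * gB (i + 1) ≤ γ ^ 2 * γ := mul_le_mul hsq hgB.2 hgB.1.le (sq_nonneg γ)
      _ = γ ^ 3 := by ring
  have hterm : ∀ i ∈ range (j + 1),
      Λ j i * ((gA i) ^ 2 * gB (i + 1)) * disc gA gB i ≤ C * γ ^ 3 * (θ ^ (j - i) * d i) := by
    intro i hi
    have hij : i ≤ j := Nat.lt_succ_iff.mp (mem_range.mp hi)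
    have hiK : i ≤ K := by omega
    obtain ⟨hw0, hwγ⟩ := hw i hiK
    calc Λ j i * ((gA i) ^ 2 * gB (i + 1)) * disc gA gB i
        ≤ (C * θ ^ (j - i)) * γ ^ 3 * d i :=
          mul_le_mul (mul_le_mul (hΛ j i hij).2 hwγ hw0 (mul_nonneg hC (pow_nonneg hθ0 _))) (hdisc i hiK)
            (disc_nonneg _ _ _) (mul_nonneg (mul_nonneg hC (pow_nonneg hθ0 _)) (pow_nonneg hγ 3))
      _ = C * γ ^ 3 * (θ ^ (j - i) * d i) := by ring
  have hS : ∑ i ∈ range (j + 1), Λ j i * ((gA i) ^ 2 * gB (i + 1)) * disc gA gB i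
      ≤ C * γ ^ 3 * ∑ i ∈ range (j + 1), θ ^ (j - i) * d i := by
    rw [Finset.mul_sum]
    exact Finset.sum_le_sum hterm
  have hd0 := hdisc j hj.le
  have hd1 := hdisc (j + 1) hj
  show |β (j + 1) (prefixOf gB (j + 1)) - β j (Fin.tail (prefixOf gB (j + 1)))|
      ≤ d j + d (j + 1) + C * γ ^ 3 * ∑ i ∈ range (j + 1), θ ^ (j - i) * d i
  linarith [h1, hS, hd0, hd1]

/-- **ℓ¹ NECESSITY, PARTIAL SUMS OF THE ENVELOPE.**  For `d ≥ 0`, `C ≥ 0`, `0 ≤ γ`, `0 ≤ θ < 1` and every `N`: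
`Σ_{j<N} (d_j + d_{j+1} + Cγ³Σ_{i≤j} θ^{j−i} d_i) ≤ (2 + Cγ³(1−θ)⁻¹)·Σ_{i≤N} d_i` — two shifted copies of the partial sum plus the exchange lemma
`NE7MarginalL1Runs.sum_Ico_sum_geom_le` at `j = 0` (each column `Σ_{m≥i} θ^{m−i} ≤ (1−θ)⁻¹`).  Hence a summable K-uniform discrepancy envelope gives a
summable K-uniform shift envelope. [folklore] -/
theorem sum_discEnvelope_le {γ θ C : ℝ} {d : ℕ → ℝ} (hθ0 : 0 ≤ θ) (hθ1 : θ < 1) (hC : 0 ≤ C) (hγ : 0 ≤ γ)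
    (hd : ∀ i, 0 ≤ d i) (N : ℕ) :
    ∑ j ∈ range N, (d j + d (j + 1) + C * γ ^ 3 * ∑ i ∈ range (j + 1), θ ^ (j - i) * d i)
      ≤ (2 + C * γ ^ 3 * (1 - θ)⁻¹) * ∑ i ∈ range (N + 1), d i := by
  have hsub : ∑ j ∈ range N, d j ≤ ∑ i ∈ range (N + 1), d i :=
    Finset.sum_le_sum_of_subset_of_nonneg (Finset.range_mono (Nat.le_succ N)) fun i _ _ => hd i
  have hshift : ∑ j ∈ range N, d (j + 1) ≤ ∑ i ∈ range (N + 1), d i := by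
    rw [Finset.sum_range_succ' d N]
    linarith [hd 0]
  have hex : ∑ j ∈ range N, ∑ i ∈ range (j + 1), θ ^ (j - i) * d i ≤ (1 - θ)⁻¹ * ∑ i ∈ range (N + 1), d i := by
    have h := NE7MarginalL1Runs.sum_Ico_sum_geom_le hθ0 hθ1 hd 0 N
    simp only [Nat.zero_sub, pow_zero, one_mul] at h
    rw [Finset.range_eq_Ico]
    have h1θ : 0 ≤ (1 - θ)⁻¹ := inv_nonneg.mpr (by linarith)
    calc ∑ j ∈ Ico 0 N, ∑ i ∈ range (j + 1), θ ^ (j - i) * d i ≤ (1 - θ)⁻¹ * ∑ i ∈ range N, d i := h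
      _ ≤ (1 - θ)⁻¹ * ∑ i ∈ range (N + 1), d i := by
          rw [← Finset.range_eq_Ico] at *
          exact mul_le_mul_of_nonneg_left hsub h1θ
  have hCγ : 0 ≤ C * γ ^ 3 := mul_nonneg hC (pow_nonneg hγ 3)
  calc ∑ j ∈ range N, (d j + d (j + 1) + C * γ ^ 3 * ∑ i ∈ range (j + 1), θ ^ (j - i) * d i)
      = ∑ j ∈ range N, d j + ∑ j ∈ range N, d (j + 1)
          + C * γ ^ 3 * ∑ j ∈ range N, ∑ i ∈ range (j + 1), θ ^ (j - i) * d i := by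
        rw [Finset.sum_add_distrib, Finset.sum_add_distrib, Finset.mul_sum]
    _ ≤ ∑ i ∈ range (N + 1), d i + ∑ i ∈ range (N + 1), d i
          + C * γ ^ 3 * ((1 - θ)⁻¹ * ∑ i ∈ range (N + 1), d i) :=
        add_le_add (add_le_add hsub hshift) (mul_le_mul_of_nonneg_left hex hCγ)
    _ = (2 + C * γ ^ 3 * (1 - θ)⁻¹) * ∑ i ∈ range (N + 1), d i := by ring

/-- **ℓ¹ NECESSITY ON THE DATA.**  A K-UNIFORM discrepancy envelope along a sequence `g₀` tuned within `]0,γ]` —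
`disc (runFlow D g₀ K) (runFlow D g₀ (K+1)) j ≤ d j` for all `j ≤ K` and all `K` (the ℓ¹ road's currency when `Σ d < ∞`; node U2's geometric output is the
case `d j = Cout·θ^j`) — with the history half of node U2's triple (`HistLipschitz Λ γ`, `FadingMemory C θ Λ`) and `BetaUpperH β′ γ` with `γ²β′ < 1` (to run
(0.20) forward) gives, for EVERY `K`, NE4 along run `K+1` under ONE K-uniform envelope:
`ShiftAlongRun (fun j ↦ d j + d (j+1) + Cγ³Σ_{i≤j}θ^{j−i} d i) D.βfun (runFlow D g₀ (K+1)) K`, whose partial sums `sum_discEnvelope_le` bounds by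
`(2 + Cγ³(1−θ)⁻¹)·Σ_{i≤N} d i`.  No window; β-side binders UNPRINTED; bookkeeping. [cite: Balaban1987RG1, (0.20) p.256, Thm 2 p.259] -/
theorem ne4AlongRuns_of_discEnvelope (D : FiniteEpsData F G) {θ γ C β' g : ℝ} {Λ : ℕ → ℕ → ℝ} {g₀ : ℕ → ℝ} {d : ℕ → ℝ}
    (hdisc : ∀ K j, j ≤ K → disc (runFlow D g₀ K) (runFlow D g₀ (K + 1)) j ≤ d j) (hθ0 : 0 ≤ θ)
    (hL : HistLipschitz Λ γ D.βfun) (hΛ : FadingMemory C θ Λ)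
    (hγ : 0 < γ) (hhi : BetaUpperH β' γ D.βfun) (hγβ : γ ^ 2 * β' < 1) (ht : D.Tuned γ g g₀) (K : ℕ) :
    ShiftAlongRun (fun j => d j + d (j + 1) + C * γ ^ 3 * ∑ i ∈ range (j + 1), θ ^ (j - i) * d i) D.βfun
      (runFlow D g₀ (K + 1)) K := by
  obtain ⟨hbox, -⟩ := box_and_pin_of_tuned D ht
  have hrun : ∀ K, RGEqH K D.βfun (runFlow D g₀ K) := fun K => rgEqH_of_tuned D hhi hγβ hγ le_rfl ht K
  exact shiftAlongRun_of_discEnvelope hθ0 hγ.le (hrun K) (hrun (K + 1)) (hbox K) (hbox (K + 1)) hL hΛ (hdisc K)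

end Summit.QuantumFields.BalabanUV.T4Continuum.Spine.NE4

end
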